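/-
COR-CM (cell pub-hodgecm2, stage 2 of the Hodge ladder) — count-neutral KERNEL COMBINATORICS «census invariance under group isomorphism»
(seat prover-pub-hodgecm2-b23-g50-0, binder prover b23, gen 50; own census lane INDEX-TWO CYCLIC 2-GROUPS, claim HOME/INBOX.md l.23042).
Two bookkeeping definitions with bodies (the relabelling of abstract CM types along a group isomorphism, as a map and as an `Equiv`) + theorems;
Mathlib-only mathematics on top of `CorCM/Prior/AllgGroup1.lean`, `Census/BlockParityLaw.lean`, `Census/CoinvariantFibre.lean`, all used BY NAME;
no `decide`, no certificate, no named fact, no `sorry`.  `Interfaces.lean` (C1), every E term, B01, `Transposition/*`, `PortJoin/*`, `D2Bridge/*` untouched.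
HONEST FRAMING: `HC_CM` is NOT proved, here or anywhere in the tree; nothing here is a period, a count of record or a headline.
T5: n/a-class (the only hypothesis binders are a group isomorphism `e : G ≃* G'` with `e c = c'` and `c·c = 1`; checker: self, 2026-08-25).
-/
import Summits.HodgeConjecture.CorCM.Census.CoinvariantFibre
import HarnessLib

/-!
# Census invariance under group isomorphism

Every invariant of the face census of a pair `(G, c)` — abstract CM types `CMF G c`, base change `rt`, flips, the rank-four face relations
`gface` / `gfaceSet`, the pairs `pairSet`, the integer Hodge lattice `hodgeSpan`, `ℤ[G]`-translates of a family, the blocks, the coinvariant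
fibre `φ₂` — is defined from the group structure and the element `c` alone, so a group isomorphism `e : G ≃* G'` with `e c = c'` carries each
of them to the corresponding invariant of `(G', c')`.  This file records that transport once and for all, so that census laws proved on a
CONCRETE model group (`QuaternionGroup n`, `DihedralGroup n`, a `SemidirectProduct`, …) apply verbatim to any abstract group — in particular to a
Galois group `GalT F` — presented by an isomorphism with the model.

* §1 `typeMap e hc : CMF G c → CMF G' c'`, `Φ ↦ e(Φ)` (`mem_typeMap : x' ∈ e(Φ) ↔ e⁻¹ x' ∈ Φ`), the bijection `typeEquiv`, and the
  equivariance `typeMap_rt : e(Ψ·Q⁻¹) = e(Ψ)·(eQ)⁻¹`, `typeMap_oflipCM`.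
* §2 the integer level: `mapDomain_gface`, `image_gfaceSet`, `mapDomain_pair`, `image_pairSet`, `image_translates`, `map_hodgeSpan`
  (`e_* hodgeSpan(G,c) = hodgeSpan(G',c')`), and the transfer of generation `generate_map`.
* §3 **the census is invariant**: `isLeast_map` — if `m` is the least number of face relations of `(G, c)` whose base changes generate the Hodge
  lattice modulo pairs, then `m` is also that number for `(G', c')`; `card_block_eq : β(G,c) = β(G',c')`.
* §4 the mod-2 level: `map_hodge2`, `map_rad2`, **`fibreTwo_eq : φ₂(G, c) = φ₂(G', c')`**.

## References
* [Pohlmann1968] H. Pohlmann, Algebraic cycles on abelian varieties of complex multiplication type, Ann. of Math. 88 (1968), Thm 1.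
-/

namespace Summit.HodgeConjecture.CorCM.Census.GroupIso

open Finset
open Summit.HodgeConjecture.CorCM.Prior.AllgGroup.RfwfAllgGroup
open Summit.HodgeConjecture.CorCM.Census.BlockParity
open Summit.HodgeConjecture.CorCM.Census.Coinvariant

noncomputable section

variable {G : Type*} [Group G] [Fintype G] [DecidableEq G] {c : G}
variable {G' : Type*} [Group G'] [Fintype G'] [DecidableEq G'] {c' : G'}
variable (e : G ≃* G') (hc : e c = c')

/-! ## §1 Relabelling CM types along a group isomorphism -/

omit [Fintype G] [DecidableEq G] [Fintype G'] [DecidableEq G'] in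
include hc in
/-- The inverse isomorphism carries `c'` back to `c`. [folklore] -/
theorem symm_apply_c : e.symm c' = c := by
  rw [← hc, MulEquiv.symm_apply_apply]

omit [Fintype G] [DecidableEq G] [Fintype G'] [DecidableEq G'] in
include hc in
/-- `c'` is an involution when `c` is. [folklore] -/
theorem map_mul_self (hc2 : c * c = 1) : c' * c' = 1 := by
  rw [← hc, ← map_mul, hc2, map_one]

omit [Fintype G] [DecidableEq G] [Fintype G'] [DecidableEq G'] in
include hc in
/-- `c' ≠ 1` when `c ≠ 1`. [folklore] -/
theorem map_ne_one (hc1 : c ≠ 1) : c' ≠ 1 := by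
  rw [← hc]
  exact fun h => hc1 (e.map_eq_one_iff.mp h)

omit [Fintype G] [DecidableEq G] [Fintype G'] [DecidableEq G'] in
include hc in
/-- `c'` is central when `c` is. [folklore] -/
theorem map_central (hcen : ∀ x : G, x * c = c * x) (x' : G') : x' * c' = c' * x' := by
  obtain ⟨x, rfl⟩ := e.surjective x'
  rw [← hc, ← map_mul, hcen x, map_mul]

/-- **Relabelling of an abstract CM type along `e`**: `e(Φ) = {x' | e⁻¹ x' ∈ Φ}`. [folklore] -/
def typeMap (Φ : CMF G c) : CMF G' c' :=
  ⟨univ.filter fun x' => e.symm x' ∈ Φ.1, by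
    intro x'
    simp only [mem_filter, mem_univ, true_and, map_mul, symm_apply_c e hc]
    exact Φ.2 (e.symm x')⟩

/-- Membership in a relabelled type: `x' ∈ e(Φ) ↔ e⁻¹ x' ∈ Φ`. [folklore] -/
@[simp] theorem mem_typeMap (Φ : CMF G c) (x' : G') : x' ∈ (typeMap e hc Φ).1 ↔ e.symm x' ∈ Φ.1 := by
  simp [typeMap]

/-- Membership in a relabelled type at an image point: `e x ∈ e(Φ) ↔ x ∈ Φ`. [folklore] -/
theorem map_mem_typeMap (Φ : CMF G c) (x : G) : e x ∈ (typeMap e hc Φ).1 ↔ x ∈ Φ.1 := by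
  rw [mem_typeMap, MulEquiv.symm_apply_apply]

/-- Relabelling along `e` and then along `e⁻¹` is the identity. [folklore] -/
theorem typeMap_symm_typeMap (Φ : CMF G c) : typeMap e.symm (symm_apply_c e hc) (typeMap e hc Φ) = Φ := by
  apply Subtype.ext
  ext x
  rw [mem_typeMap, MulEquiv.symm_symm, map_mem_typeMap]

/-- Relabelling along `e⁻¹` and then along `e` is the identity. [folklore] -/
theorem typeMap_typeMap_symm (Φ' : CMF G' c') : typeMap e hc (typeMap e.symm (symm_apply_c e hc) Φ') = Φ' := by
  apply Subtype.ext
  ext x'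
  rw [mem_typeMap, mem_typeMap, MulEquiv.symm_symm, MulEquiv.apply_symm_apply]

/-- **The relabelling bijection** `CMF G c ≃ CMF G' c'` along `e`. [folklore] -/
def typeEquiv : CMF G c ≃ CMF G' c' where
  toFun := typeMap e hc
  invFun := typeMap e.symm (symm_apply_c e hc)
  left_inv := typeMap_symm_typeMap e hc
  right_inv := typeMap_typeMap_symm e hc

/-- The relabelling bijection is `typeMap` as a function. [folklore] -/
@[simp] theorem coe_typeEquiv : ⇑(typeEquiv e hc) = typeMap e hc := rfl

/-- Relabelling is injective. [folklore] -/
theorem typeMap_injective : Function.Injective (typeMap e hc) := (typeEquiv e hc).injective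

/-- Relabelling is surjective. [folklore] -/
theorem typeMap_surjective : Function.Surjective (typeMap e hc) := (typeEquiv e hc).surjective

/-- **Relabelling commutes with base change**: `e(Ψ·Q⁻¹) = e(Ψ)·(eQ)⁻¹`. [folklore] -/
theorem typeMap_rt (Q : G) (Ψ : CMF G c) : typeMap e hc (rt c Q Ψ) = rt c' (e Q) (typeMap e hc Ψ) := by
  apply Subtype.ext
  ext x'
  rw [mem_typeMap, mem_rt, mem_rt, mem_typeMap, map_mul, MulEquiv.symm_apply_apply]

omit [Fintype G] [Fintype G'] in
include hc in
/-- Places correspond: `e x ∈ {e t, c'·e t} ↔ x ∈ {t, c·t}`. [folklore] -/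
theorem map_mem_orb_iff (t x : G) : e x ∈ orb c' (e t) ↔ x ∈ orb c t := by
  rw [mem_orb, mem_orb, ← hc, ← map_mul, e.apply_eq_iff_eq, e.apply_eq_iff_eq]

omit [Fintype G] [Fintype G'] in
include hc in
/-- Places correspond (inverse form): `x' ∈ {e t, c'·e t} ↔ e⁻¹ x' ∈ {t, c·t}`. [folklore] -/
theorem mem_orb_map_iff (t : G) (x' : G') : x' ∈ orb c' (e t) ↔ e.symm x' ∈ orb c t := by
  rw [← map_mem_orb_iff e hc t (e.symm x'), MulEquiv.apply_symm_apply]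

/-- **Relabelling commutes with flips**: `e(Ψ^{(t)}) = e(Ψ)^{(e t)}`. [folklore] -/
theorem typeMap_oflipCM (hc2 : c * c = 1) (hc2' : c' * c' = 1) (t : G) (Ψ : CMF G c) :
    typeMap e hc (oflipCM c hc2 t Ψ) = oflipCM c' hc2' (e t) (typeMap e hc Ψ) := by
  apply Subtype.ext
  ext x'
  change x' ∈ (typeMap e hc (oflipCM c hc2 t Ψ)).1 ↔ x' ∈ oflip c' (e t) (typeMap e hc Ψ).1
  rw [mem_typeMap, oflip, mem_symmDiff, mem_typeMap, mem_orb_map_iff e hc]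
  change e.symm x' ∈ oflip c t Ψ.1 ↔ _
  rw [oflip, mem_symmDiff]

/-! ## §2 The integer level: faces, pairs, translates, the Hodge lattice -/

/-- **Relabelling carries a face relation to a face relation**: `e_*(gface Ψ t t') = gface e(Ψ) (e t) (e t')`. [folklore] -/
theorem mapDomain_gface (hc2 : c * c = 1) (hc2' : c' * c' = 1) (Ψ : CMF G c) (t t' : G) :
    Finsupp.mapDomain (typeMap e hc) (gface c hc2 Ψ t t') = gface c' hc2' (typeMap e hc Ψ) (e t) (e t') := by
  unfold gface
  simp only [Finsupp.mapDomain_add, Finsupp.mapDomain_sub, Finsupp.mapDomain_single, typeMap_oflipCM e hc hc2 hc2']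

/-- Relabelling along `e⁻¹` then `e` is the identity on `ℤ[types]` (any coefficients). [folklore] -/
theorem mapDomain_typeMap_symm {M : Type*} [AddCommMonoid M] (y' : CMF G' c' →₀ M) :
    Finsupp.mapDomain (typeMap e hc) (Finsupp.mapDomain (typeMap e.symm (symm_apply_c e hc)) y') = y' := by
  rw [← Finsupp.mapDomain_comp]
  convert Finsupp.mapDomain_id using 2
  funext Φ'
  exact typeMap_typeMap_symm e hc Φ'

/-- Relabelling along `e` then `e⁻¹` is the identity on `ℤ[types]` (any coefficients). [folklore] -/
theorem mapDomain_symm_typeMap {M : Type*} [AddCommMonoid M] (y : CMF G c →₀ M) :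
    Finsupp.mapDomain (typeMap e.symm (symm_apply_c e hc)) (Finsupp.mapDomain (typeMap e hc) y) = y := by
  rw [← Finsupp.mapDomain_comp]
  convert Finsupp.mapDomain_id using 2
  funext Φ
  exact typeMap_symm_typeMap e hc Φ

/-- Relabelling is injective on `ℤ[types]` (any coefficients). [folklore] -/
theorem mapDomain_typeMap_injective {M : Type*} [AddCommMonoid M] :
    Function.Injective (Finsupp.mapDomain (M := M) (typeMap e hc)) :=
  Finsupp.mapDomain_injective (typeMap_injective e hc)

/-- **The face relations correspond**: `e_*(gfaceSet(G, c)) = gfaceSet(G', c')`. [folklore] -/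
theorem image_gfaceSet (hc2 : c * c = 1) (hc2' : c' * c' = 1) :
    Finsupp.mapDomain (typeMap e hc) '' gfaceSet G c hc2 = gfaceSet G' c' hc2' := by
  ext y'
  constructor
  · rintro ⟨y, ⟨Ψ, t, t', ht, rfl⟩, rfl⟩
    exact ⟨typeMap e hc Ψ, e t, e t', fun h => ht ((map_mem_orb_iff e hc t t').mp h), mapDomain_gface e hc hc2 hc2' Ψ t t'⟩
  · rintro ⟨Ψ', t₁, t₂, ht, rfl⟩
    refine ⟨gface c hc2 (typeMap e.symm (symm_apply_c e hc) Ψ') (e.symm t₁) (e.symm t₂), ⟨_, _, _, fun h => ht ?_, rfl⟩, ?_⟩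
    · rwa [← MulEquiv.apply_symm_apply e t₁, ← MulEquiv.apply_symm_apply e t₂, map_mem_orb_iff e hc]
    · rw [mapDomain_gface e hc hc2 hc2', typeMap_typeMap_symm, MulEquiv.apply_symm_apply, MulEquiv.apply_symm_apply]

/-- **Relabelling carries a pair to a pair**: `e_*([Ψ] + [Ψ·c]) = [e(Ψ)] + [e(Ψ)·c']`. [folklore] -/
theorem mapDomain_pair (Ψ : CMF G c) : Finsupp.mapDomain (typeMap e hc) (pair c Ψ) = pair c' (typeMap e hc Ψ) := by
  rw [pair, pair, Finsupp.mapDomain_add, Finsupp.mapDomain_single, Finsupp.mapDomain_single, typeMap_rt, hc]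

/-- **The pairs correspond**: `e_*(pairSet c) = pairSet c'`. [folklore] -/
theorem image_pairSet : Finsupp.mapDomain (typeMap e hc) '' pairSet c = pairSet c' := by
  ext y'
  constructor
  · rintro ⟨_, ⟨Ψ, rfl⟩, rfl⟩
    exact ⟨typeMap e hc Ψ, (mapDomain_pair e hc Ψ).symm⟩
  · rintro ⟨Ψ', rfl⟩
    refine ⟨pair c (typeMap e.symm (symm_apply_c e hc) Ψ'), pair_mem_pairSet c _, ?_⟩
    rw [mapDomain_pair, typeMap_typeMap_symm]

/-- **Translates correspond**: `e_*(ℤ[G]·S) = ℤ[G']·e_*(S)`. [folklore] -/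
theorem image_translates (S : Finset (CMF G c →₀ ℤ)) :
    Finsupp.mapDomain (typeMap e hc) '' translates c S = translates c' (S.image (Finsupp.mapDomain (typeMap e hc))) := by
  ext y'
  constructor
  · rintro ⟨_, ⟨Q, s, hs, rfl⟩, rfl⟩
    refine ⟨e Q, Finsupp.mapDomain (typeMap e hc) s, mem_image_of_mem _ hs, ?_⟩
    rw [← Finsupp.mapDomain_comp, ← Finsupp.mapDomain_comp]
    congr 1
    funext Ψ
    exact typeMap_rt e hc Q Ψ
  · rintro ⟨Q', s', hs', rfl⟩
    obtain ⟨s, hs, rfl⟩ := mem_image.mp hs'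
    refine ⟨Finsupp.mapDomain (rt c (e.symm Q')) s, ⟨e.symm Q', s, hs, rfl⟩, ?_⟩
    rw [← Finsupp.mapDomain_comp, ← Finsupp.mapDomain_comp]
    congr 1
    funext Ψ
    change typeMap e hc (rt c (e.symm Q') Ψ) = rt c' Q' (typeMap e hc Ψ)
    rw [typeMap_rt, MulEquiv.apply_symm_apply]

/-- The relabelling as a `ℤ`-linear map of exponent lattices is `mapDomain`. [folklore] -/
theorem coe_lmapDomain : ⇑(Finsupp.lmapDomain ℤ ℤ (typeMap e hc) : (CMF G c →₀ ℤ) →ₗ[ℤ] (CMF G' c' →₀ ℤ)) =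
    Finsupp.mapDomain (typeMap e hc) := rfl

/-- Relabelling a span: `e_*(ℤ⟨s⟩) = ℤ⟨e_* s⟩`. [folklore] -/
theorem map_span (s : Set (CMF G c →₀ ℤ)) :
    (Submodule.span ℤ s).map (Finsupp.lmapDomain ℤ ℤ (typeMap e hc)) = Submodule.span ℤ (Finsupp.mapDomain (typeMap e hc) '' s) := by
  rw [Submodule.map_span, coe_lmapDomain]

/-- **The Hodge lattices correspond**: `e_*(hodgeSpan(G, c)) = hodgeSpan(G', c')`. [folklore] -/
theorem map_hodgeSpan (hc2 : c * c = 1) (hc2' : c' * c' = 1) :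
    (hodgeSpan c hc2).map (Finsupp.lmapDomain ℤ ℤ (typeMap e hc)) = hodgeSpan c' hc2' := by
  rw [hodgeSpan, hodgeSpan, Submodule.map_sup, map_span, map_span, image_gfaceSet e hc hc2 hc2', image_pairSet]

/-- **Transfer of generation**: if the base changes of `S` generate `hodgeSpan(G, c)` modulo pairs, then the base changes of `e_*(S)` generate
`hodgeSpan(G', c')` modulo pairs. [folklore] -/
theorem generate_map (hc2 : c * c = 1) (hc2' : c' * c' = 1) {S : Finset (CMF G c →₀ ℤ)}
    (h : hodgeSpan c hc2 ≤ Submodule.span ℤ (pairSet c) ⊔ Submodule.span ℤ (translates c S)) :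
    hodgeSpan c' hc2' ≤ Submodule.span ℤ (pairSet c') ⊔
      Submodule.span ℤ (translates c' (S.image (Finsupp.mapDomain (typeMap e hc)))) := by
  have h' := Submodule.map_mono (f := Finsupp.lmapDomain ℤ ℤ (typeMap e hc)) h
  rwa [map_hodgeSpan e hc hc2 hc2', Submodule.map_sup, map_span, map_span, image_pairSet, image_translates] at h'

/-- A family of face relations relabels to a family of face relations. [folklore] -/
theorem image_subset_gfaceSet (hc2 : c * c = 1) (hc2' : c' * c' = 1) {S : Finset (CMF G c →₀ ℤ)} (hS : ↑S ⊆ gfaceSet G c hc2) :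
    ↑(S.image (Finsupp.mapDomain (typeMap e hc))) ⊆ gfaceSet G' c' hc2' := by
  rw [coe_image, ← image_gfaceSet e hc hc2 hc2']
  exact Set.image_mono hS

/-- Relabelling a family does not change its size. [folklore] -/
theorem card_image (S : Finset (CMF G c →₀ ℤ)) : (S.image (Finsupp.mapDomain (typeMap e hc))).card = S.card :=
  card_image_of_injective S (mapDomain_typeMap_injective e hc)

/-! ## §3 The census is invariant -/

include e hc in
/-- A face count realised for `(G, c)` is realised for `(G', c')`. [folklore] -/
theorem mem_census_map (hc2 : c * c = 1) (hc2' : c' * c' = 1) {m : ℕ}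
    (hm : m ∈ {m : ℕ | ∃ S : Finset (CMF G c →₀ ℤ), (↑S ⊆ gfaceSet G c hc2) ∧ S.card = m ∧
      hodgeSpan c hc2 ≤ Submodule.span ℤ (pairSet c) ⊔ Submodule.span ℤ (translates c S)}) :
    m ∈ {m : ℕ | ∃ S : Finset (CMF G' c' →₀ ℤ), (↑S ⊆ gfaceSet G' c' hc2') ∧ S.card = m ∧
      hodgeSpan c' hc2' ≤ Submodule.span ℤ (pairSet c') ⊔ Submodule.span ℤ (translates c' S)} := by
  obtain ⟨S, hS, rfl, hgen⟩ := hm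
  exact ⟨S.image (Finsupp.mapDomain (typeMap e hc)), image_subset_gfaceSet e hc hc2 hc2' hS, card_image e hc S,
    generate_map e hc hc2 hc2' hgen⟩

include e hc in
/-- **THE FACE CENSUS IS AN ISOMORPHISM INVARIANT**: if `m` is the least number of rank-four face relations of `(G, c)` whose base changes
generate the integer Hodge lattice modulo pairs, then `m` is also that least number for `(G', c')`, for every group isomorphism
`e : G ≃* G'` with `e c = c'`. [folklore] -/
theorem isLeast_map (hc2 : c * c = 1) (hc2' : c' * c' = 1) {m : ℕ}
    (hm : IsLeast {m : ℕ | ∃ S : Finset (CMF G c →₀ ℤ), (↑S ⊆ gfaceSet G c hc2) ∧ S.card = m ∧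
      hodgeSpan c hc2 ≤ Submodule.span ℤ (pairSet c) ⊔ Submodule.span ℤ (translates c S)} m) :
    IsLeast {m : ℕ | ∃ S : Finset (CMF G' c' →₀ ℤ), (↑S ⊆ gfaceSet G' c' hc2') ∧ S.card = m ∧
      hodgeSpan c' hc2' ≤ Submodule.span ℤ (pairSet c') ⊔ Submodule.span ℤ (translates c' S)} m := by
  refine ⟨mem_census_map e hc hc2 hc2' hm.1, fun k hk => hm.2 ?_⟩
  exact mem_census_map e.symm (symm_apply_c e hc) hc2' hc2 hk

include e hc in
/-- **The blocks correspond**: `β(G, c) = β(G', c')`. [folklore] -/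
theorem card_block_eq : Fintype.card (Block c) = Fintype.card (Block c') := by
  refine Fintype.card_congr (Quotient.congr (typeEquiv e hc) fun Ψ₁ Ψ₂ => ?_)
  change (∃ Q : G, rt c Q Ψ₁ = Ψ₂) ↔ (∃ Q' : G', rt c' Q' (typeMap e hc Ψ₁) = typeMap e hc Ψ₂)
  constructor
  · rintro ⟨Q, rfl⟩
    exact ⟨e Q, (typeMap_rt e hc Q Ψ₁).symm⟩
  · rintro ⟨Q', hQ'⟩
    refine ⟨e.symm Q', typeMap_injective e hc ?_⟩
    rw [typeMap_rt, MulEquiv.apply_symm_apply, hQ']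

/-! ## §4 The mod-2 level: `φ₂` is invariant -/

/-- Relabelling commutes with reduction mod `2`. [folklore] -/
theorem red_mapDomain_typeMap (y : CMF G c →₀ ℤ) :
    red c' (Finsupp.mapDomain (typeMap e hc) y) = Finsupp.mapDomain (typeMap e hc) (red c y) := by
  rw [red_apply, red_apply]
  exact (Finsupp.mapDomain_mapRange (typeMap e hc) y (fun n : ℤ => (n : ZMod 2)) Int.cast_zero (fun a b => Int.cast_add a b)).symm

/-- Relabelling an image under `red`: `e_*(red X) = red (e_* X)`. [folklore] -/
theorem image_red_image (X : Set (CMF G c →₀ ℤ)) :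
    Finsupp.mapDomain (typeMap e hc) '' (red c '' X) = red c' '' (Finsupp.mapDomain (typeMap e hc) '' X) := by
  rw [Set.image_image, Set.image_image]
  exact Set.image_congr fun y _ => (red_mapDomain_typeMap e hc y).symm

/-- The faces mod `2` correspond. [folklore] -/
theorem image_faces2 (hc2 : c * c = 1) (hc2' : c' * c' = 1) :
    Finsupp.mapDomain (typeMap e hc) '' faces2 c hc2 = faces2 c' hc2' := by
  rw [faces2, faces2, image_red_image, image_gfaceSet e hc hc2 hc2']

/-- The coboundaries mod `2` correspond. [folklore] -/
theorem image_cobdry (hc2 : c * c = 1) (hc2' : c' * c' = 1) :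
    Finsupp.mapDomain (typeMap e hc) '' cobdry c hc2 = cobdry c' hc2' := by
  have hcomp : ∀ (Q : G) (x : CMF G c →₀ ZMod 2), Finsupp.mapDomain (typeMap e hc) (Finsupp.mapDomain (rt c Q) x) =
      Finsupp.mapDomain (rt c' (e Q)) (Finsupp.mapDomain (typeMap e hc) x) := by
    intro Q x
    rw [← Finsupp.mapDomain_comp, ← Finsupp.mapDomain_comp]
    congr 1
    funext Ψ
    exact typeMap_rt e hc Q Ψ
  ext y'
  constructor
  · rintro ⟨_, ⟨Q, x, hx, rfl⟩, rfl⟩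
    refine ⟨e Q, Finsupp.mapDomain (typeMap e hc) x, ?_, ?_⟩
    · rw [← image_faces2 e hc hc2 hc2']
      exact ⟨x, hx, rfl⟩
    · rw [Finsupp.mapDomain_sub, hcomp]
  · rintro ⟨Q', x', hx', rfl⟩
    rw [← image_faces2 e hc hc2 hc2'] at hx'
    obtain ⟨x, hx, rfl⟩ := hx'
    refine ⟨Finsupp.mapDomain (rt c (e.symm Q')) x - x, ⟨e.symm Q', x, hx, rfl⟩, ?_⟩
    rw [Finsupp.mapDomain_sub, hcomp, MulEquiv.apply_symm_apply]

/-- The relabelling as an `𝔽₂`-linear isomorphism of `𝔽₂[types]`. [folklore] -/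
def domCongrTwo : (CMF G c →₀ ZMod 2) ≃ₗ[ZMod 2] (CMF G' c' →₀ ZMod 2) := Finsupp.domLCongr (typeEquiv e hc)

/-- `domCongrTwo` is `mapDomain` along the relabelling. [folklore] -/
theorem coe_domCongrTwo : ⇑(domCongrTwo e hc : (CMF G c →₀ ZMod 2) →ₗ[ZMod 2] (CMF G' c' →₀ ZMod 2)) = Finsupp.mapDomain (typeMap e hc) := by
  funext v
  change (domCongrTwo e hc) v = _
  rw [domCongrTwo, Finsupp.domLCongr_apply, Finsupp.domCongr_apply, Finsupp.equivMapDomain_eq_mapDomain, coe_typeEquiv]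

/-- Relabelling a span mod `2`. [folklore] -/
theorem map_span2 (s : Set (CMF G c →₀ ZMod 2)) :
    (Submodule.span (ZMod 2) s).map (domCongrTwo e hc : (CMF G c →₀ ZMod 2) →ₗ[ZMod 2] (CMF G' c' →₀ ZMod 2)) =
      Submodule.span (ZMod 2) (Finsupp.mapDomain (typeMap e hc) '' s) := by
  rw [Submodule.map_span, coe_domCongrTwo]

/-- **The Hodge lattices mod `2` correspond.** [folklore] -/
theorem map_hodge2 (hc2 : c * c = 1) (hc2' : c' * c' = 1) :
    (hodge2 c hc2).map (domCongrTwo e hc : (CMF G c →₀ ZMod 2) →ₗ[ZMod 2] (CMF G' c' →₀ ZMod 2)) = hodge2 c' hc2' := by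
  rw [hodge2, hodge2, Submodule.map_sup, face2, face2, pair2, pair2, map_span2, map_span2, image_faces2 e hc hc2 hc2',
    image_red_image, image_pairSet]

/-- **The radicals mod `2` correspond.** [folklore] -/
theorem map_rad2 (hc2 : c * c = 1) (hc2' : c' * c' = 1) :
    (rad2 c hc2).map (domCongrTwo e hc : (CMF G c →₀ ZMod 2) →ₗ[ZMod 2] (CMF G' c' →₀ ZMod 2)) = rad2 c' hc2' := by
  rw [rad2, rad2, Submodule.map_sup, pair2, pair2, aug2, aug2, map_span2, map_span2, image_red_image, image_pairSet,
    image_cobdry e hc hc2 hc2']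

include e hc in
/-- **THE COINVARIANT FIBRE IS AN ISOMORPHISM INVARIANT**: `φ₂(G, c) = φ₂(G', c')`. [folklore] -/
theorem fibreTwo_eq (hc2 : c * c = 1) (hc2' : c' * c' = 1) : fibreTwo c hc2 = fibreTwo c' hc2' := by
  have hr := map_rad2 e hc hc2 hc2'
  have hcomp : ((Submodule.Quotient.equiv (rad2 c hc2) (rad2 c' hc2') (domCongrTwo e hc) hr :
        ((CMF G c →₀ ZMod 2) ⧸ rad2 c hc2) ≃ₗ[ZMod 2] ((CMF G' c' →₀ ZMod 2) ⧸ rad2 c' hc2')) :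
        ((CMF G c →₀ ZMod 2) ⧸ rad2 c hc2) →ₗ[ZMod 2] ((CMF G' c' →₀ ZMod 2) ⧸ rad2 c' hc2')) ∘ₗ (rad2 c hc2).mkQ =
      (rad2 c' hc2').mkQ ∘ₗ (domCongrTwo e hc : (CMF G c →₀ ZMod 2) →ₗ[ZMod 2] (CMF G' c' →₀ ZMod 2)) := by
    apply LinearMap.ext
    intro x
    rfl
  have hfib : (fibre c hc2).map ((Submodule.Quotient.equiv (rad2 c hc2) (rad2 c' hc2') (domCongrTwo e hc) hr :
        ((CMF G c →₀ ZMod 2) ⧸ rad2 c hc2) ≃ₗ[ZMod 2] ((CMF G' c' →₀ ZMod 2) ⧸ rad2 c' hc2')) :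
        ((CMF G c →₀ ZMod 2) ⧸ rad2 c hc2) →ₗ[ZMod 2] ((CMF G' c' →₀ ZMod 2) ⧸ rad2 c' hc2')) = fibre c' hc2' := by
    rw [fibre, fibre, ← Submodule.map_comp, hcomp, Submodule.map_comp, map_hodge2 e hc hc2 hc2']
  rw [fibreTwo, fibreTwo, ← hfib, LinearEquiv.finrank_map_eq]

end

end Summit.HodgeConjecture.CorCM.Census.GroupIso
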